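import Summits.BirchSwinnertonDyer.BirchSwinnertonDyer.Theorems.DefiniteThetaDerivedHeightCapIwasawaSerreTower
import HarnessLib

/-!
# Orders of vanishing and `μ` through the Iwasawa–Serre identification: `θ_n ∈ I_n^ρ ∀ n ⟺ X^ρ ∣ L`, `ord = ord_X L`, `μ = 0 ⟺ p ∤ L`

Route-independent `Theorems` file (cell `b2b-bsdres`, seat `b2b-bsdres-x10b`, gen 46), part 18 of the series «tower square root»
serving crux `DerivedHeightCap` (stmt-BirchSwinnertonDyer-18438, route DefiniteTheta; definition request D2 of the route).
HONEST FRAMING: no curve asserted, no class closed, BSD not proved by any of this.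

Setting of parts 3 and 17 (a `ℤ_p`-tower `G_n` with coherent generators `γ_n` and unbounded orders `p^{e_n}`); `L ∈ ℤ_p⟦X⟧` and its family
of images `θ_n ∈ ℤ_p[G_n]` (part 17: every coherent family is the image family of exactly one `L`).  BD05 §1.2 reads the order of
vanishing and the `μ`-invariant of the anticyclotomic `p`-adic `L`-function `L_f ∈ Λ ≅ ℤ_p⟦T⟧` off its finite layers; this file proves
that dictionary:

* §1 ★ `forall_mem_augIdeal_pow_iff_X_pow_dvd`: **`θ_n ∈ I_n^ρ` for every `n` ⟺ `X^ρ ∣ L`** (⇐: `X ↦ γ_n − 1 ∈ I_n`; ⇒: `θ_n ∈ I_n^ρ =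
  ((γ_n−1)^ρ)` forces `L ≡ X^ρ Q_n (mod ω_{e_n})`, so `p^{e_n − k} ∣ coeff_k L` for `k < ρ` and all `n` — Kummer, part 16 — and `e_n → ∞`);
* §2 ★ `iSup_mem_augIdeal_pow_eq_order`: **the order of vanishing `sup {ρ : θ_n ∈ I_n^ρ ∀ n} ∈ ℕ∞` equals `PowerSeries.order L`**;
* §3 ★ `exists_forall_isUnit_coeff_iff_not_C_dvd`: **some coefficient of `θ_n` is a unit for all large `n` ⟺ `p ∤ L` in `ℤ_p⟦X⟧`**
  (`μ(L) = 0` in Pollack–Weston's normalisation), and `exists_isUnit_coeff_of_not_C_dvd` (then EVERY level `n` with `e_n` large has a unit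
  coefficient);
* §4 `order_eq_order_of_images_mapDomain_inv` (`ord_X L^* = ord_X L` for the power series `L^*` of the involuted family `ι θ_n`) and
  ★ `forall_mul_mapDomain_inv_mem_iff`: **`θ_n · ι(θ_n) ∈ I_n^ρ` for all `n` iff `ρ ≤ 2 ord_X L`** (`ℤ_p⟦X⟧` is a domain) — the dictionary
  for BD05's `L_p(E, K) = L_f L_f^*` (and a second proof of the square root of part 3).

## References
* [Washington1997] L. C. Washington, *Introduction to Cyclotomic Fields*, 2nd ed., §7.1, Thm. 7.1; §13.2.
* [BertoliniDarmon2005] M. Bertolini, H. Darmon, Ann. of Math. 162 (2005), §1.2 (18)–(21) and Cor. 3.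
* [PollackWeston2011] R. Pollack, T. Weston, *On anticyclotomic μ-invariants of modular forms*, Compos. Math. 147 (2011), §2.3.
-/

noncomputable section

open scoped BigOperators Polynomial

-- D-0017: single-problem summit, the namespace repeats the problem name by design.
set_option linter.dupNamespace false

namespace Summit.BirchSwinnertonDyer.BirchSwinnertonDyer.Theorems.TowerSqrt

open Literature.NumberTheory.EllipticCurves (augIdeal)

universe u

variable (p : ℕ) [hp : Fact p.Prime]

section Tower

variable {G : ℕ → Type u} [∀ n, CommGroup (G n)] (hfin : ∀ n, Finite (G n))
  (π : ∀ n, G (n + 1) →* G n) (γ : ∀ n, G n) (hγ : ∀ n, π n (γ (n + 1)) = γ n)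
  (hgen : ∀ n (g : G n), ∃ k : ℕ, γ n ^ k = g)
  (e : ℕ → ℕ) (hcard : ∀ n, Nat.card (G n) = p ^ e n)

/-! ### §1 Powers of the augmentation ideals ⟷ powers of `X` -/

include hfin hgen hcard in
/-- ★ **`θ_n ∈ I_n^ρ` for all `n` iff `X^ρ ∣ L`** (`θ_n` the images of `L`, `e_n` unbounded): BD05's "`L_f ∈ J^ρ` iff all its finite images
lie in `I^ρ`" (ideals of `Λ` are closed). [cite: BertoliniDarmon2005, §1.2 (18)–(21)] [cite: Washington1997, §7.1 Thm. 7.1] -/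
theorem forall_mem_augIdeal_pow_iff_X_pow_dvd (he : ∀ N : ℕ, ∃ n, N ≤ e n) {L : PowerSeries ℤ_[p]}
    {θ : ∀ n, MonoidAlgebra ℤ_[p] (G n)}
    (hL : ∀ n (R : ℤ_[p][X]), ((1 + PowerSeries.X : PowerSeries ℤ_[p]) ^ p ^ e n - 1) ∣ L - (R : PowerSeries ℤ_[p]) →
      (Polynomial.aeval (R := ℤ_[p]) (MonoidAlgebra.of ℤ_[p] _ (γ n) - 1)) R = θ n)
    (ρ : ℕ) : (∀ n, θ n ∈ augIdeal ℤ_[p] (G n) ^ ρ) ↔ (PowerSeries.X : PowerSeries ℤ_[p]) ^ ρ ∣ L := by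
  constructor
  · intro h
    rw [PowerSeries.X_pow_dvd_iff]
    intro k hk
    -- p^{e n - k} ∣ coeff k L for every n
    refine eq_zero_of_forall_pow_dvd' p (fun n => e n - k) (fun i => ?_) fun n => ?_
    · obtain ⟨n, hn⟩ := he (i + k)
      exact ⟨n, by omega⟩
    · haveI := hfin n
      obtain ⟨Q, hQ⟩ := exists_X_pow_mul_of_mem_augIdeal_pow p (γ n) (e n) (gen_pow_card p γ e hcard n) (hgen n) (hcard n)
        (hL n) ρ (h n)
      have h1 := pow_dvd_coeff_of_omega_dvd p (e n) k hQ
      rwa [map_sub, PowerSeries.coeff_X_pow_mul', if_neg (not_le.mpr hk), sub_zero] at h1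
  · intro h n
    exact mem_augIdeal_pow_of_image p (γ n) (e n) (hL n) ρ h

/-! ### §2 The order of vanishing is the `X`-adic order of `L` -/

/-- `X^ρ ∣ L` iff `ρ ≤ ord_X L` (in `ℕ∞`). [folklore] -/
theorem X_pow_dvd_iff_le_order (L : PowerSeries ℤ_[p]) (ρ : ℕ) :
    (PowerSeries.X : PowerSeries ℤ_[p]) ^ ρ ∣ L ↔ (ρ : ℕ∞) ≤ L.order := by
  rw [PowerSeries.X_pow_dvd_iff]
  constructor
  · intro h
    exact PowerSeries.nat_le_order L ρ h
  · intro h m hm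
    exact PowerSeries.coeff_of_lt_order m (lt_of_lt_of_le (by exact_mod_cast hm) h)

include hfin hgen hcard in
/-- ★ **The order of vanishing along the tower is `ord_X L`**: `sup {ρ : θ_n ∈ I_n^ρ for all n} = PowerSeries.order L` in `ℕ∞`
(`⊤` iff `L = 0` iff all `θ_n = 0`). This is BD05's `ord_J L_f = ½ ord_{s=1} L_p(E, K, s)` read off the finite layers.
[cite: BertoliniDarmon2005, §1.2 and Cor. 3] -/
theorem iSup_mem_augIdeal_pow_eq_order (he : ∀ N : ℕ, ∃ n, N ≤ e n) {L : PowerSeries ℤ_[p]}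
    {θ : ∀ n, MonoidAlgebra ℤ_[p] (G n)}
    (hL : ∀ n (R : ℤ_[p][X]), ((1 + PowerSeries.X : PowerSeries ℤ_[p]) ^ p ^ e n - 1) ∣ L - (R : PowerSeries ℤ_[p]) →
      (Polynomial.aeval (R := ℤ_[p]) (MonoidAlgebra.of ℤ_[p] _ (γ n) - 1)) R = θ n) :
    (⨆ (ρ : ℕ) (_ : ∀ n, θ n ∈ augIdeal ℤ_[p] (G n) ^ ρ), (ρ : ℕ∞)) = L.order := by
  have key : ∀ ρ : ℕ, (∀ n, θ n ∈ augIdeal ℤ_[p] (G n) ^ ρ) ↔ (ρ : ℕ∞) ≤ L.order := fun ρ =>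
    (forall_mem_augIdeal_pow_iff_X_pow_dvd p hfin γ hgen e hcard he hL ρ).trans (X_pow_dvd_iff_le_order p L ρ)
  refine le_antisymm (iSup₂_le fun ρ hρ => (key ρ).mp hρ) ?_
  -- the reverse inequality: every natural number below `L.order` is attained
  refine ENat.forall_natCast_le_iff_le.mp fun m hm => ?_
  exact le_iSup₂ (f := fun (ρ : ℕ) (_ : ∀ n, θ n ∈ augIdeal ℤ_[p] (G n) ^ ρ) => (ρ : ℕ∞)) m ((key m).mpr hm)

/-! ### §3 `μ = 0`: unit coefficients ⟷ `p ∤ L` -/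

/-- `p ∣ L` in `ℤ_p⟦X⟧` iff `p` divides every coefficient. [folklore] -/
theorem C_dvd_iff_forall_dvd_coeff (L : PowerSeries ℤ_[p]) :
    (PowerSeries.C (p : ℤ_[p]) : PowerSeries ℤ_[p]) ∣ L ↔ ∀ k, (p : ℤ_[p]) ∣ PowerSeries.coeff k L := by
  constructor
  · rintro ⟨M, rfl⟩ k
    rw [PowerSeries.coeff_C_mul]
    exact dvd_mul_right _ _
  · intro h
    choose c hc using h
    refine ⟨PowerSeries.mk c, PowerSeries.ext fun k => ?_⟩
    rw [PowerSeries.coeff_C_mul, PowerSeries.coeff_mk, hc]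

include hfin hgen hcard in
/-- **If `p ∤ L` then at every level `n` with `e_n` beyond the first unit coefficient of `L`, some coefficient of `θ_n` is a unit**
(otherwise `θ_n ∈ p ℤ_p[G_n]` and `p ∣ coeff_k L` for all `k < e_n`, part 16). [cite: PollackWeston2011, §2.3] -/
theorem exists_isUnit_coeff_of_not_C_dvd {L : PowerSeries ℤ_[p]} {θ : ∀ n, MonoidAlgebra ℤ_[p] (G n)}
    (hL : ∀ n (R : ℤ_[p][X]), ((1 + PowerSeries.X : PowerSeries ℤ_[p]) ^ p ^ e n - 1) ∣ L - (R : PowerSeries ℤ_[p]) →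
      (Polynomial.aeval (R := ℤ_[p]) (MonoidAlgebra.of ℤ_[p] _ (γ n) - 1)) R = θ n)
    {k : ℕ} (hk : ¬ (p : ℤ_[p]) ∣ PowerSeries.coeff k L) (n : ℕ) (hn : k < e n) :
    ∃ g : G n, IsUnit ((θ n).coeff g) := by
  by_contra hne
  push Not at hne
  haveI := hfin n
  exact hk (dvd_coeff_of_image_of_forall_not_isUnit p (γ n) (e n) (gen_pow_card p γ e hcard n) (hgen n) (hcard n) (hL n) hne k hn)

include hfin hγ hgen hcard in
/-- ★ **`μ = 0` on the layers iff `p ∤ L`**: some coefficient of `θ_n` is a `p`-adic unit for all large `n` (the finite-level form of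
`μ(L_f) = 0`, Pollack–Weston 2011 §2.3: "`μ(Q)` is the largest `c` with `Q ∈ 𝔭^c Λ`") iff `p` does not divide `L` in `ℤ_p⟦X⟧`.
[cite: PollackWeston2011, §2.3] [cite: BertoliniDarmon2005, §1.2 (18)–(21)] -/
theorem exists_forall_isUnit_coeff_iff_not_C_dvd (he : ∀ N : ℕ, ∃ n, N ≤ e n) {L : PowerSeries ℤ_[p]}
    {θ : ∀ n, MonoidAlgebra ℤ_[p] (G n)}
    (hL : ∀ n (R : ℤ_[p][X]), ((1 + PowerSeries.X : PowerSeries ℤ_[p]) ^ p ^ e n - 1) ∣ L - (R : PowerSeries ℤ_[p]) →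
      (Polynomial.aeval (R := ℤ_[p]) (MonoidAlgebra.of ℤ_[p] _ (γ n) - 1)) R = θ n) :
    (∃ n₀ : ℕ, ∀ n, n₀ ≤ n → ∃ g : G n, IsUnit ((θ n).coeff g)) ↔ ¬ (PowerSeries.C (p : ℤ_[p]) : PowerSeries ℤ_[p]) ∣ L := by
  constructor
  · rintro ⟨n₀, hn₀⟩ hdvd
    obtain ⟨g, hg⟩ := hn₀ n₀ le_rfl
    exact not_isUnit_coeff_of_image_of_C_dvd p (γ n₀) (e n₀) (hL n₀) hdvd g hg
  · intro hnd
    rw [C_dvd_iff_forall_dvd_coeff] at hnd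
    push Not at hnd
    obtain ⟨k, hk⟩ := hnd
    obtain ⟨n₀, hn₀⟩ := he (k + 1)
    refine ⟨n₀, fun n hn => exists_isUnit_coeff_of_not_C_dvd p hfin γ hgen e hcard hL hk n ?_⟩
    have hmono := e_monotone p hfin π γ hγ hgen e hcard hn
    omega

include hfin hγ hgen hcard in
/-- **One unit coefficient at one (large) level suffices**: if some `θ_{n₁}` with `e_{n₁} ≥ 1`… more precisely, if `p ∣ L` fails — which ONE
level `n₁` with a unit coefficient already forces — then all large levels have unit coefficients. Stated: a unit coefficient at some level
`n₁` implies unit coefficients at all levels `n ≥ n₀` for some `n₀`. [cite: PollackWeston2011, §2.3] -/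
theorem exists_forall_isUnit_coeff_of_exists (he : ∀ N : ℕ, ∃ n, N ≤ e n) {L : PowerSeries ℤ_[p]}
    {θ : ∀ n, MonoidAlgebra ℤ_[p] (G n)}
    (hL : ∀ n (R : ℤ_[p][X]), ((1 + PowerSeries.X : PowerSeries ℤ_[p]) ^ p ^ e n - 1) ∣ L - (R : PowerSeries ℤ_[p]) →
      (Polynomial.aeval (R := ℤ_[p]) (MonoidAlgebra.of ℤ_[p] _ (γ n) - 1)) R = θ n)
    {n₁ : ℕ} (h : ∃ g : G n₁, IsUnit ((θ n₁).coeff g)) :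
    ∃ n₀ : ℕ, ∀ n, n₀ ≤ n → ∃ g : G n, IsUnit ((θ n).coeff g) := by
  refine (exists_forall_isUnit_coeff_iff_not_C_dvd p hfin π γ hγ hgen e hcard he hL).mpr fun hdvd => ?_
  obtain ⟨g, hg⟩ := h
  exact not_isUnit_coeff_of_image_of_C_dvd p (γ n₁) (e n₁) (hL n₁) hdvd g hg

/-! ### §4 The involution `ι` and products `θ · ι(θ)` -/

/-- `ι = (σ ↦ σ⁻¹)_*` preserves every `I^ρ` and is an involution, so `ι θ_n ∈ I_n^ρ ∀ n ⟺ θ_n ∈ I_n^ρ ∀ n`. [folklore] -/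
theorem forall_mapDomain_inv_mem_iff (θ : ∀ n, MonoidAlgebra ℤ_[p] (G n)) (ρ : ℕ) :
    (∀ n, MonoidAlgebra.mapDomain (fun σ => σ⁻¹) (θ n) ∈ augIdeal ℤ_[p] (G n) ^ ρ) ↔ ∀ n, θ n ∈ augIdeal ℤ_[p] (G n) ^ ρ := by
  refine forall_congr' fun n => ⟨fun h => ?_, fun h => mapDomain_inv_mem_augIdeal_pow ℤ_[p] ρ h⟩
  have := mapDomain_inv_mem_augIdeal_pow ℤ_[p] ρ h
  rwa [mapDomain_inv_mapDomain_inv ℤ_[p]] at this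

include hfin hgen hcard in
/-- **`ord_X L^* = ord_X L`**: if `L` has images `θ_n` and `L^*` has images `ι(θ_n)`, the two power series have the same `X`-adic order
(no functional equation is needed: `ι` preserves the augmentation filtration). [cite: BertoliniDarmon2005, §1.2 (18)–(21)] -/
theorem order_eq_order_of_images_mapDomain_inv (he : ∀ N : ℕ, ∃ n, N ≤ e n) {L Lstar : PowerSeries ℤ_[p]}
    {θ : ∀ n, MonoidAlgebra ℤ_[p] (G n)}
    (hL : ∀ n (R : ℤ_[p][X]), ((1 + PowerSeries.X : PowerSeries ℤ_[p]) ^ p ^ e n - 1) ∣ L - (R : PowerSeries ℤ_[p]) →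
      (Polynomial.aeval (R := ℤ_[p]) (MonoidAlgebra.of ℤ_[p] _ (γ n) - 1)) R = θ n)
    (hLstar : ∀ n (R : ℤ_[p][X]), ((1 + PowerSeries.X : PowerSeries ℤ_[p]) ^ p ^ e n - 1) ∣ Lstar - (R : PowerSeries ℤ_[p]) →
      (Polynomial.aeval (R := ℤ_[p]) (MonoidAlgebra.of ℤ_[p] _ (γ n) - 1)) R = MonoidAlgebra.mapDomain (fun σ => σ⁻¹) (θ n)) :
    Lstar.order = L.order := by
  rw [← iSup_mem_augIdeal_pow_eq_order p hfin γ hgen e hcard he hL,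
    ← iSup_mem_augIdeal_pow_eq_order p hfin γ hgen e hcard he hLstar]
  exact iSup_congr fun ρ => by rw [forall_mapDomain_inv_mem_iff]

include hfin hgen hcard in
/-- **`θ_n · ι(θ_n) ∈ I_n^ρ` for all `n` iff `ρ ≤ 2 ord_X L`**: the product family has images from `L · L^*` (part 17), `ℤ_p⟦X⟧` is a
domain (`ord (L L^*) = ord L + ord L^*`) and `ord L^* = ord L`.  With `ρ = 2s` this is the dictionary behind BD05's reading of
`L_p(E, K) = L_f L_f^* ∈ J^{2s}` and behind the square root of part 3. [cite: BertoliniDarmon2005, §1.2 (18)–(21) and Cor. 3] -/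
theorem forall_mul_mapDomain_inv_mem_iff (he : ∀ N : ℕ, ∃ n, N ≤ e n) {L Lstar : PowerSeries ℤ_[p]}
    {θ : ∀ n, MonoidAlgebra ℤ_[p] (G n)}
    (hL : ∀ n (R : ℤ_[p][X]), ((1 + PowerSeries.X : PowerSeries ℤ_[p]) ^ p ^ e n - 1) ∣ L - (R : PowerSeries ℤ_[p]) →
      (Polynomial.aeval (R := ℤ_[p]) (MonoidAlgebra.of ℤ_[p] _ (γ n) - 1)) R = θ n)
    (hLstar : ∀ n (R : ℤ_[p][X]), ((1 + PowerSeries.X : PowerSeries ℤ_[p]) ^ p ^ e n - 1) ∣ Lstar - (R : PowerSeries ℤ_[p]) →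
      (Polynomial.aeval (R := ℤ_[p]) (MonoidAlgebra.of ℤ_[p] _ (γ n) - 1)) R = MonoidAlgebra.mapDomain (fun σ => σ⁻¹) (θ n))
    (ρ : ℕ) :
    (∀ n, θ n * MonoidAlgebra.mapDomain (fun σ => σ⁻¹) (θ n) ∈ augIdeal ℤ_[p] (G n) ^ ρ) ↔ (ρ : ℕ∞) ≤ L.order + L.order := by
  have hprod := images_mul p γ e hcard hL hLstar
  rw [forall_mem_augIdeal_pow_iff_X_pow_dvd p hfin γ hgen e hcard he hprod ρ, X_pow_dvd_iff_le_order p, PowerSeries.order_mul,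
    order_eq_order_of_images_mapDomain_inv p hfin γ hgen e hcard he hL hLstar]

end Tower

end Summit.BirchSwinnertonDyer.BirchSwinnertonDyer.Theorems.TowerSqrt

end
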